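import Summits.Ventures.YMGap.Statement
import Summits.Ventures.YMGap.StatementConjunctsV17
import Summits.Ventures.YMGap.StatementConjunctsV18
import Summits.Ventures.YMGap.StatementConjunctsV19
import Summits.Ventures.YMGap.StatementConjunctsV20
import Summits.Ventures.YMGap.StatementConjunctsV20B
import Summits.Ventures.YMGap.StatementConjunctsV21
import Summits.Ventures.YMGap.StatementConjunctsV21B
import Summits.Ventures.YMGap.StatementConjunctsV22
import Summits.Ventures.YMGap.StatementConjunctsV22B
import Summits.Ventures.YMGap.StatementConjunctsV22C
import Summits.Ventures.YMGap.StatementConjunctsV22D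
import Summits.Ventures.YMGap.StatementConjunctsV23
import Summits.Ventures.YMGap.StatementConjunctsV23B
import Summits.Ventures.YMGap.StatementConjunctsV23C
import Summits.Ventures.YMGap.StatementConjunctsV23E
import Summits.Ventures.YMGap.StatementConjunctsV23F
import Summits.Ventures.YMGap.StatementConjunctsV23G
import Summits.Ventures.YMGap.StatementConjunctsV23H
import Summits.Ventures.YMGap.StatementConjunctsV23I
import Summits.Ventures.YMGap.StatementConjunctsV23J
import HarnessLib

/-!
# Venture statement — YMGap (cell `pub-ymgap`) — INDEX CONTINUATION (PLAN R215): `YMGapStatementV1_7` and later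

CONTINUATION of the `Statement.lean` index; `Summits/Ventures/YMGap/Statement.lean` is FROZEN at v1.6 (`YMGapStatementV1_6`,
T1–T31 with T29 reserved) for length (400-line cap). From v1.7 on every index append
`YMGapStatementV1_k := YMGapStatementV1_{k-1} ∧ …` + `yMGapStatementV1_k_holds` is appended HERE (append-only, earlier
declarations byte-identical, meanings unchanged; one index append in flight at a time); the conjunct BODIES keep living in
per-version block files `StatementConjunctsV1k.lean` with their plain-language docstrings and honest framing.

HONEST FRAMING (unchanged from `Statement.lean`). WHAT THIS IS: the theorem-level output of the cell as ONE `Prop` — kernel-checked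
statements about the STRONG-COUPLING regime of lattice `SU(N)` Yang–Mills (also with the Wilson action replaced by members of typed
perturbation balls, track Y2) and about Tomboulis's 2007 vortex inequalities on FINITE tori / in two dimensions (track (b)). WHAT
THIS IS NOT: no continuum statement, no mass gap at any fixed physical coupling, no clustering rate beyond the displayed ones /
`∃ m > 0`, no claim on the Yang–Mills Millennium problem, no verdict on Tomboulis's disputed (5.15) in `d ≥ 3`. Every threshold /
ball radius is where a BOUND is certified to close, not a physical transition. Conditional conjuncts display their hypotheses as
binders (T2, T6, T8, T19, T20 inside `YMGapStatementV1_6`); T28 is a refutation. It STAYS A DRAFT until the operator adopts it.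
Conjunct index of the continuation: v1.7 — T32, T33 (`StatementConjunctsV17`: track Y2 TIER 2, every DLR state of every member of the
weighted infinite-range `ℤ⁴` ball is massive — `SU(2)` door form and the all-`N` row at 't Hooft `1/64`; R215 (iii)) · v1.8 — T34, T35,
T36 (`StatementConjunctsV18`: the Wilson string tension exists at every coupling and the Wilson limit states confine on the certified windows;
Tomboulis's interpolation parameters `α_Λ`, `α⁺_Λ` exist uniquely + the crossing criterion for Ito–Seiler's Problem 2; track Y2's sprint point of
record — the mass gap uniformly on the GAUGE-INVARIANT tier-1 `ℤ⁴` ball at `β⋆_W = 1/8`, `ε = 0.148`) · v1.9 — T29 (`StatementConjunctsV19`: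
track Y4, the `SU(2)` YM₃ infrared INTERFACE — Bałaban's `d = 3` UV theorems as printed + the named infrared hypothesis ⇒ volume-uniform
clustering along cofinal tori, displayed WITH the kernel fact that the unpinned hypothesis is target-equivalent, and the gauge-covariant pinned
form as a SUFFICIENT condition; a typed dictionary, not a reduction), T37 (Wilson action, `SU(2)` `d = 4`, `0 < β_W ≤ 9/25`: ONE state, massive
AND confining; Wilson's joint string-tension formula every `N`, `d`, `β > 0`), T38 (track Y2: ONE state on the gauge-invariant ball — van Hove join,
door form + `SU(2)` up to `β_W = 1/3`, every `N` at `1/64`, `SU(3)` at `1/4`), T39 (track (b): Tomboulis III.2 / IV.4 for every `b ≥ 2` on `f_c ≥ 0` +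
the axial-forest identity) · v1.10 — T40, T41, T42, T43, T44, T47, T48 (`StatementConjunctsV20` + `StatementConjunctsV20B`: track Y2 / Wilson action
at strong coupling — ONE STATE from EVERY boundary condition, uniformly, translation and axis-permutation invariant (Wilson: also the only torus limit
point) (T40); track (b) — the census germ law (G) on every 3-torus + the typed census conjecture C-1 ⟺ one sign condition per plane on two Haar
moments, C-1 itself OPEN (T41); the DLR state C¹ in the coupling with the plaquette-response formula (T42); the centre-tube area law with one (C, c)
for all tori (T43); every-N star rows at 't Hooft 1/64, 1/36 + SU(3) rows at the PV modulus (T44); Wilson's strong-coupling string-tension law with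
explicit O(1) error + one state (T47); the logarithmic clustering rate log(1/(8β_W)) (T48)). ·
v1.11 — T49, T50, T51, T52, T53, T54 (`StatementConjunctsV21` + `StatementConjunctsV21B`: track Y2 / Wilson action at strong coupling — one state AT A
RATE — exponential insensitivity to the boundary condition on the tier-1 ball and at the Wilson point (T49); the one state is tail trivial / short-
range / ergodic and local in the action (T50); the DLR state Lipschitz and C¹ in the coupling in every dimension (T51); track (b): the vortex free
energy of Wilson's theory is strictly positive on every finite torus of side 2^(n+1), β ≠ 0 — Tomboulis IV.1 strict (T52); the ceiling-side strong-
coupling laws for σ and the mean plaquette (T53); the signed data cut's Y2 lead cell (1/8, 0.223) and its SU(2) ladder (T54)). ·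
v1.12 — T55, T56, T57, T58, T59, T46, T60, T62, T63, T65, T61 (`StatementConjunctsV22` + `StatementConjunctsV22B` + `StatementConjunctsV22C` +
`StatementConjunctsV22D`: track Y2 / Wilson thermodynamics at strong coupling — the free-energy law with explicit two-sided strong-coupling bounds,
every `N`, every `d`, the internal-energy law and the weak-coupling floor (T55); the pressure `C¹`/`C²` on the strong-coupling window with the
thermodynamic identities — not analyticity (T56); one state AT A RATE uniformly on the weighted tier-2 ball (T57), for the mixed action and `d = 3`
(T58), for Wilson loops and free boundary conditions (T59); track (a): the every-`N` level-two one-link ladder — `ℤ⁴` thresholds, the area law in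
every `d`, the `d = 3` / `d = 5…8` ladders (T46, the number reserved since R253); `SU(3)` every-`d` rows and ball segments at the PV2 modulus (T60);
torus / box finite-size rates at the Wilson point, reflection invariance of the one state, gauge invariance of every DLR state (T62) and the `SU(2)`
one-state master theorem at `|β_W| ≤ 1/9` (T63); the quantitative centre tube + the centre-blind star window (T65); `β = 0` Haar product with the
Balian–Drouffe–Itzykson coefficients, monotone mean plaquette, the two-sided window `|β| < 9/50` through `β = 0` (T61)). ·
v1.13 — T64 (`StatementConjunctsV23`: source screening + action truncation at the clustering rate on the balls). ·
v1.14 — T69, T70 (`StatementConjunctsV23B`: a local source creates no phase (one Wilson loop of any strength at the SU(2) Wilson point; bounded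
finitely-listed sources on the tier-2 ball)). ·
v1.15 — T66, T71 (`StatementConjunctsV23C`: Gaussian concentration / self-averaging of SU(2) lattice Yang–Mills (McDiarmid for specification kernels;
ℤ⁴ β_W ≤ 1/12, tier-1 ball, torus); the SU(3) hypothesis-free PV2T column (twisted one-link Poincaré constant; every-d mass gap, ball and area-law
segments)). ·
v1.16 — T65c, T75, T76, T77, T78, T79, T80, T81 (`StatementConjunctsV23E` + `StatementConjunctsV23F`: COMBINED append (lead g13 R349 (A) / R360) over
the blocks BUILT now = V23E + V23F (the planned v1.17 + v1.18; T72–T74 of V23D ride the next append when its olean exists): the centre-blind ball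
window; fluctuation–response + specific heat + a.s. energy density inside the star window; no first-order transition + Lipschitz torus states on the
tier-1 torus ball; the all-coupling perimeter-type bound for the centre-blind class; complete convergence of cube averages at the Wilson point;
boundary decay and finite-volume clustering at the star rate on the whole star window; the Dobrushin–Shlosman Condition-I shape of the free energy).
·
v1.17 — T82, T83 (`StatementConjunctsV23G`: G-ONLY append (lead g13 R377 (B) over R349 (A)) of the block BUILT now = V23G; T72–T74 (V23D) PRECEDE
T82–T83 in numbering and enter at the next edition when their olean builds — a build-lane artefact, not a withdrawal: exact SU(N) Haar third/sixth
trace moments; the real-analytic strong-coupling corner for SU(2)/SU(N) (analytic free energy with convergent BDI series, analytic DLR selections,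
zero-free torus partition functions, Cauchy bounds) on an explicit Kotecký–Preiss radius). ·
v1.18 — T84, T85, T86, T87, T88, T89, T90, T91 (`StatementConjunctsV23H` + `StatementConjunctsV23I`: COMBINED append per lead g13 R377 (B)(3) / lead
g14 R380 over the blocks BUILT at filing = V23H + V23I (T72–T74 of V23D still PRECEDE T82+ in numbering and enter when their olean builds — a build-
lane artefact, not a withdrawal): the local-source package; finite-volume kernel clustering uniform in volume and boundary field; Langevin / Glauber
functional inequalities on the KR window; twisted one-link Poincaré constants for every SU(N); a finite-volume energy-variance ceiling; SU(3) ball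
area-law / string-tension segments; all-groups DLR uniqueness on the TV-Dobrushin corner; the DS Condition-I shape of the SU(N) free energy). ·
v1.19 — T92, T93, T94 (`StatementConjunctsV23J`: J-ONLY append per lead g14 R385 (C) / R389 (B)(2) over the block BUILT at filing = V23J (T72–T74 of
V23D still PRECEDE T82+ in numbering and enter when their olean builds — a build-lane artefact, not a withdrawal): SU(N) Haar fourth moments and the
vanishing SU(3) fourth cumulants at β = 0; SU(2) finite-volume plaquette susceptibility bounded, convergent and boundary-insensitive inside the star
window 0 ≤ β_W ≤ 9/25; Langevin / Glauber Poincaré inequalities and exponential concentration for every SU(2) DLR state on the KR window 0 ≤ β_W <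
2/9). Plain-language table of every conjunct: the cell's `lean/STATEMENT-V1-SUMMARY.md`.
-/

noncomputable section

namespace Summit.Ventures.YMGap

/-- **The venture statement, DRAFT v1.7** (PLAN R215; bodies in `StatementConjunctsV17.lean`):
`YMGapStatementV1_6 ∧ T32 ∧ T33` — T32 `SU(2)`, `d = 4`: under the tier-2 door `6|β_W| e^{a} e^{t} + e^{a/2} √(2/3) Λ < 1` every
member of `MemBallZdS a Λ t` has DLR states, all massive with plaquette–plaquette decay; T33 every `N ≥ 2` at 't Hooft `1/64`: the
tier-2 row `MassGapOnBallZdS 4 N (1/64) (1/20) (1/10) (log(6/5))` and its massive-state form — both unconditional. -/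
def YMGapStatementV1_7 : Prop :=
  YMGapStatementV1_6 ∧ T32_SU2TierTwoBallMassive ∧ T33_SUNTierTwoBallMassive

/-- The v1.7 draft statement is PROVED (T32, T33 hypothesis-free; the conditional conjuncts of `YMGapStatementV1_6` keep their
displayed hypotheses inside). -/
theorem yMGapStatementV1_7_holds : YMGapStatementV1_7 :=
  ⟨yMGapStatementV1_6_holds, T32_SU2TierTwoBallMassive_holds, T33_SUNTierTwoBallMassive_holds⟩

/-- **The venture statement, DRAFT v1.8** (bodies in `StatementConjunctsV18.lean`): `YMGapStatementV1_7 ∧ T34 ∧ T35 ∧ T36` — T34 the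
Wilson string tension exists at every coupling and every Wilson limit state confines on the certified windows (`SU(2)` `0 < β_W < 2/(d−1)`,
all `N` on the CNS window); T35 Tomboulis's interpolation parameters exist uniquely + the crossing criterion for Ito–Seiler's Problem 2
(nothing asserted about any instance); T36 track Y2's sprint point of record on the gauge-invariant `ℤ⁴` ball — all unconditional. -/
def YMGapStatementV1_8 : Prop :=
  YMGapStatementV1_7 ∧ T34_WilsonStringTensionConfinement ∧ T35_TomboulisInterpolationParameter ∧ T36_SU2GaugeInvariantBallMassGap

/-- The v1.8 draft statement is PROVED. -/
theorem yMGapStatementV1_8_holds : YMGapStatementV1_8 :=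
  ⟨yMGapStatementV1_7_holds, T34_WilsonStringTensionConfinement_holds, T35_TomboulisInterpolationParameter_holds,
    T36_SU2GaugeInvariantBallMassGap_holds⟩

/-- **The venture statement, DRAFT v1.9** (bodies in `StatementConjunctsV19.lean`): `YMGapStatementV1_8 ∧ T29 ∧ T37 ∧ T38 ∧ T39` — T29 (track Y4, reserved since
v1.5, PLAN R200/R215, Sunday item (15)): the `SU(2)` YM₃ infrared INTERFACE — (A) `BalabanUV3 mk` ∧ `IRConjecture3` on track Y2's certified `d = 3`
row ⇒ `MassGap3Cofinal` on Bałaban's coupling set, displayed with the kernel equivalence of the unpinned hypothesis with the target (so the UV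
hypothesis is logically idle there); (B) the gauge-covariant, block-local pinned hypothesis `IRConjecture3Cov` on the hypothesis-free tier-2 ball as a
SUFFICIENT condition (converse not known) with the two kernel edges of the covariance clause. A typed dictionary between the UV track, track Y2 and
the lattice infrared problem — NOT a reduction of the mass gap; unconditional as a kernel theorem (its content is an implication + equivalences);
T37 Wilson action `SU(2)` `d = 4`: one state, massive and confining on `0 < β_W ≤ 9/25` + Wilson's joint string-tension formula; T38 one state on
the gauge-invariant `ℤ⁴` ball (van Hove join; rows); T39 Tomboulis's lower bounds III.2 / IV.4 for every `b ≥ 2` on the positivity domain + the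
forest identity — all unconditional. -/
def YMGapStatementV1_9 : Prop :=
  YMGapStatementV1_8 ∧ T29_YM3Infrared ∧ T37_SU2OneStateMassiveConfining ∧ T38_OneStateOnBall ∧ T39_TomboulisLowerBoundsEveryB

/-- The v1.9 draft statement is PROVED. -/
theorem yMGapStatementV1_9_holds : YMGapStatementV1_9 :=
  ⟨yMGapStatementV1_8_holds, T29_YM3Infrared_holds, T37_SU2OneStateMassiveConfining_holds, T38_OneStateOnBall_holds,
    T39_TomboulisLowerBoundsEveryB_holds⟩

/-- **The venture statement, DRAFT v1.10** (bodies in `StatementConjunctsV20` + `StatementConjunctsV20B`; lead R253/R254): `YMGapStatementV1_9 ∧ T40 ∧ T41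
∧ T42 ∧ T43 ∧ T44 ∧ T47 ∧ T48` — T40 (track Y2 / Wilson action, seat ds-3): under the one-state hypotheses (`PerturbedMassGapAt` with the displayed
regularity / covariance binders for members of the tier-1 ball, `MassGapAt` for the Wilson action), every `d`, `N`, `β`: the ONE DLR state is the
limit of the finite-volume Gibbs distributions with EVERY boundary field along every cofinal sequence of volumes, uniformly in the boundary field; it
is translation invariant and axis-permutation invariant (members: under the corresponding covariance of the Hamiltonians); for the Wilson action it is
also the only torus limit point; T41 (track (b), seats lit-2 / engine-1): the germ law (G) of the typed census conjecture C-1 holds on EVERY 3-torus,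
C-1 is EQUIVALENT to two Haar-moment statements per plane (the first of which holds by (G)) and hence to ONE sign condition per plane on two explicit
`SU(2)` Haar moments — «what is proved of C-1 and exactly what remains»; C-1 itself is NOT asserted and stays an open EMPIRICAL LAW; T42 (seat ds-1):
the strong-coupling DLR state is `C¹` in the coupling with the plaquette-response series as derivative (`SU(2)` `d = 4` on `0 < β_W < 9/25`; every
`SU(N)` hypothesis-free at 't Hooft `< 9/308`) — `C¹` only, not analyticity; T43 (seat ds-4): the centre tube — ONE `(C, c)` area law for all tori
around EVERY twist-blind action perturbed inside the range-`r` tier-1 ball (`2(d−1)N|β| + K(d,r)ε₀ < 1`, `K` a counting constant), the `SU(2)` range-1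
row, the `1×2`-rectangle member with explicit rate, and the limit-state string-tension bound (`σ ≥ c` whenever it exists); T44 (seats ds-2 / engine-2
/ ds-3): every-`N` hypothesis-free rows through the robust star door at 't Hooft `1/64` and `1/36` (`ℤ⁴`, torus `d = 4`; `d = 3` at `1/24`) + the
`SU(3)` rows at the PV modulus (segments to `β_W = 31/100` on `ℤ⁴` / `12/25` in `d = 3`, one state at `31/100`, string-tension bound at `43/100`, the
variance-form cell at `1/4`) — additional to T11–T14 / T18 / T24 / T33 / T38; T47 (seat rb-p2): Wilson's strong-coupling string-tension law with
explicit O(1) error (`SU(2)`: `|σ − log(4/β_W)| ≤ log 6 + 24β_W` on `0 < β_W ≤ 2/3`; every `N`: `|σ − log(N/β)| ≤ log 24 + 24Nβ` on `0 < β ≤ N/24`),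
its uniform asymptotic form, the two-sided static potential, and one state on `0 < β_W ≤ 9/25` — leading coefficient exact, constant not sharp; T48
(seat rb-p1): the logarithmic clustering rate `log(1/(8β_W))` (constant 16) for every DLR state of `SU(2)` Wilson on `ℤ⁴`, `0 < β_W < 1/8`, and
uniformly on the weighted loop-action ball — a bound (coefficient 1 vs the physical ≈ 4), not the sharp rate. All unconditional; strong-coupling
lattice statements on balls of actions / finite-torus census facts; every window or radius is where a bound closes; nothing continuum, nothing about
the Millennium problem. -/
def YMGapStatementV1_10 : Prop :=
  YMGapStatementV1_9 ∧ T40_OneStateBoundaryAndSymmetry ∧ T41_TwistCensusGermLaw ∧ T42_CouplingResponse ∧ T43_CentreTube ∧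
    T44_StarRowsEveryNAndSU3PV ∧ T47_WilsonStrongCouplingLaw ∧ T48_LogarithmicRate

/-- The v1.10 draft statement is PROVED. -/
theorem yMGapStatementV1_10_holds : YMGapStatementV1_10 :=
  ⟨yMGapStatementV1_9_holds, T40_OneStateBoundaryAndSymmetry_holds, T41_TwistCensusGermLaw_holds, T42_CouplingResponse_holds,
    T43_CentreTube_holds, T44_StarRowsEveryNAndSU3PV_holds, T47_WilsonStrongCouplingLaw_holds, T48_LogarithmicRate_holds⟩

/-- **The venture statement, DRAFT v1.11** (bodies in `StatementConjunctsV21` + `StatementConjunctsV21B`; lead R278): `YMGapStatementV1_10 ∧ T49 ∧ T50 ∧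
T51 ∧ T52 ∧ T53 ∧ T54` — T49 (seat ds-3): inside the single-link doors the finite-volume expectation of a Lipschitz cylinder at depth `D` with ANY
boundary field differs from the one state's by `≤ 2√2·K·#Δ·max(ρ,½)^{⌊D/max(1,R)⌋}` — `SU(2)` every `d` on the tier-1 ball, every `N` (Bakry–Émery),
the Wilson point on `ℤ⁴`; T50 (seat ds-3): under `MassGapAt` the one state is tail trivial, short-range for all events and ergodic, and it is local in
the action at the clustering rate; T51 (seat ds-1): the DLR state is Lipschitz in the coupling on the star windows and `C¹` (`ContDiffOn ℝ 1`) with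
the response formula for every `SU(N)` in every `d ≥ 2` — not analyticity; T52 (track (b), seat lit-2): Tomboulis's Prop. IV.1 STRICT clause for the
Wilson action — `Z(z) < Z(1)` on every torus of side `2^(n+1)`, every `β ≠ 0`, every compact `G` with a non-trivial central element, one plane and
every plane, `SU(N)` instances (nothing about the truncated character actions); T53 (seat rb-p2): the ceiling-side strong-coupling laws (`σ ≤` linear
ceiling, the law with vanishing ceiling-side constant, the two-sided mean-plaquette law and limits, `SU(2)` and every `SU(N)`, `d = 4`); T54 (seats
ds-2 / rb-theory): the signed data cut's lead cell `MassGapOnBallZdG 4 2 (1/32) (223/500) (223/1000) R` and the `SU(2)` star-variational ladder. All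
unconditional; strong-coupling lattice statements / finite-torus facts; every window or radius is where a bound closes; nothing continuum, nothing
about the Millennium problem. -/
def YMGapStatementV1_11 : Prop :=
  YMGapStatementV1_10 ∧ T49_OneStateBoundaryRate ∧ T50_OneStateTailTrivialLocal ∧ T51_CouplingLipschitzC1 ∧ T52_VortexFreeEnergyPositive ∧
    T53_StrongCouplingCeilingLaws ∧ T54_SU2LeadCellStarVar

/-- The v1.11 draft statement is PROVED. -/
theorem yMGapStatementV1_11_holds : YMGapStatementV1_11 :=
  ⟨yMGapStatementV1_10_holds, T49_OneStateBoundaryRate_holds, T50_OneStateTailTrivialLocal_holds, T51_CouplingLipschitzC1_holds,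
    T52_VortexFreeEnergyPositive_holds, T53_StrongCouplingCeilingLaws_holds, T54_SU2LeadCellStarVar_holds⟩

/-- **The venture statement, DRAFT v1.12** (bodies in `StatementConjunctsV22` + `StatementConjunctsV22B` + `StatementConjunctsV22C` +
`StatementConjunctsV22D`): `YMGapStatementV1_11 ∧ T55 ∧ T56 ∧ T57 ∧ T58 ∧ T59 ∧ T46 ∧ T60 ∧ T62 ∧ T63 ∧ T65 ∧ T61` — lead R294/R299/R301 + V22
BOOKING; track Y2 / Wilson thermodynamics at strong coupling — THE FREE-ENERGY LAW: `SU(2)` `ℤ⁴` `f` exists at every `β_W ≥ 0` with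
`(3/4)β_W²e^{−54β_W} ≤ f + 6β_W ≤ (3/4)β_W²e^{72β_W}` and ratio `→ 1`, the every-`N` / every-`d` two-sided law, the internal-energy law, the sandwich
+ weak-coupling floor (T55, seat rb-p2); the pressure is `C¹`/`C²` on the strong-coupling window with the thermodynamic identities `f′ = −Σ(N − ⟨Re tr
U_p⟩)`, `f″ =` susceptibility `≥ 0`, `SU(2)` and every `SU(N)`, every `d` — not analyticity (T56, seat ds-1); one state AT A RATE — the boundary-field
rate uniformly on the weighted tier-2 ball (T57), for the mixed fundamental–adjoint action and `d = 3` (T58), for Wilson loops and FREE boundary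
conditions (T59) (seat ds-3); track (a): the every-`N` LEVEL-TWO one-link ladder — `ℤ⁴` thresholds `N₀ = 3 … 50 ↦ x₀ = 33/1000 … 11/240`, the area law
in every `d` for `N ≥ 4 … 50`, the `d = 3` and `d = 5 … 8` ladders (T46, seat p2 — the number reserved since R253); `SU(3)` at the PV2 modulus —
every-`d` row `(d−1)|β_W| ≤ 19/20`, `d = 3 … 6` rows, ball segments to `β_W = 17/50` (`ℤ⁴`) / `13/25` (`ℤ³`) (T60, seat engine-2, countersigned text);
torus / box finite-size rates at the Wilson point `β_W ≤ 1/9`, reflection invariance of the one state, gauge invariance of EVERY DLR state, periodised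
ball members (T62) and the `SU(2)` one-state master theorem at `|β_W| ≤ 1/9` (T63) (seat ds-3); the quantitative centre tube `2(d−1)N|β| + √N ε₁ < 1 ⇒
AreaLawCentreTubeFR` + the centre-blind star window (T65, seat ds-4); `β = 0`: THE DLR state is the Haar product with the Balian–Drouffe–Itzykson
leading coefficients, the mean plaquette is monotone on the window, and the TWO-SIDED window `|β| < 9/50` through `β = 0`: `C²`, `f′(0) = −12`, `f″(0)
= 6`, one state, `u` odd (T61, seat ds-1; block «4 of 4»). All unconditional; strong-coupling lattice statements on balls of actions / finite-torus
facts; every window or radius is where a bound closes; nothing continuum, nothing about the Millennium problem. -/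
def YMGapStatementV1_12 : Prop :=
  YMGapStatementV1_11 ∧ T55_FreeEnergyStrongCouplingLaw ∧ T56_PressureSmoothStrongCoupling ∧ T57_SummableBoundaryRateBall ∧
    T58_BoundaryRateMixedAndDim3 ∧ T59_LoopAndFreeBoundaryRate ∧ T46_SUNLevelTwoLadder ∧ T60_SU3PV2Column ∧ T62_TorusFiniteSizeAndInvariance
    ∧ T63_SU2WilsonOneStateMasterRate ∧ T65_CentreTubeQuantitative ∧ T61_ZeroCouplingMonotoneTwoSided

/-- The v1.12 draft statement is PROVED. -/
theorem yMGapStatementV1_12_holds : YMGapStatementV1_12 :=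
  ⟨yMGapStatementV1_11_holds, T55_FreeEnergyStrongCouplingLaw_holds, T56_PressureSmoothStrongCoupling_holds,
    T57_SummableBoundaryRateBall_holds, T58_BoundaryRateMixedAndDim3_holds, T59_LoopAndFreeBoundaryRate_holds, T46_SUNLevelTwoLadder_holds,
    T60_SU3PV2Column_holds, T62_TorusFiniteSizeAndInvariance_holds, T63_SU2WilsonOneStateMasterRate_holds, T65_CentreTubeQuantitative_holds,
    T61_ZeroCouplingMonotoneTwoSided_holds⟩

/-- **The venture statement, DRAFT v1.13** (bodies in `StatementConjunctsV23`): `YMGapStatementV1_12 ∧ T64` — local and loop sources of any strength are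
screened at the one-sided Dobrushin-comparison (clustering) rate uniformly on the tier-1 ball (SU(2) d = 4, every N), on the tier-2 weighted ball and
at the SU(2) Wilson point with one loop of any strength, and the same rate controls action truncation. All unconditional; strong-coupling lattice
statements on balls of actions / finite-torus facts; every window or radius is where a bound closes; nothing continuum, nothing about the Millennium
problem. -/
def YMGapStatementV1_13 : Prop :=
  YMGapStatementV1_12 ∧ T64_SourceScreeningAndTruncation

/-- The v1.13 draft statement is PROVED. -/
theorem yMGapStatementV1_13_holds : YMGapStatementV1_13 :=
  ⟨yMGapStatementV1_12_holds, T64_SourceScreeningAndTruncation_holds⟩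

/-- **The venture statement, DRAFT v1.14** (bodies in `StatementConjunctsV23B`): `YMGapStatementV1_13 ∧ T69 ∧ T70` — a LOCAL SOURCE CREATES NO PHASE: at
the SU(2) Wilson point 0 ≤ β_W ≤ 1/3 the action plus ONE Wilson loop of ANY strength has exactly one DLR state (T69), and on the tier-2 weighted ball
every bounded source with finitely many listed terms keeps the DLR state unique (T70). All unconditional; strong-coupling lattice statements on balls
of actions / finite-torus facts; every window or radius is where a bound closes; nothing continuum, nothing about the Millennium problem. -/
def YMGapStatementV1_14 : Prop :=
  YMGapStatementV1_13 ∧ T69_LocalSourceNoPhase ∧ T70_TierTwoLocalSourceNoPhase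

/-- The v1.14 draft statement is PROVED. -/
theorem yMGapStatementV1_14_holds : YMGapStatementV1_14 :=
  ⟨yMGapStatementV1_13_holds, T69_LocalSourceNoPhase_holds, T70_TierTwoLocalSourceNoPhase_holds⟩

/-- **The venture statement, DRAFT v1.15** (bodies in `StatementConjunctsV23C`): `YMGapStatementV1_14 ∧ T66 ∧ T71` — GAUSSIAN CONCENTRATION OF SPATIAL
AVERAGES: the McDiarmid–Azuma bound for the kernels of any specification and every Gibbs measure of it, and the self-averaging of gauge-invariant
local observables (incl. the plaquette) of SU(2) on ℤ⁴ at 0 ≤ β_W ≤ 1/12, uniformly on the tier-1 ball and on the torus (T66 = T66a–e); and the SU(3)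
HYPOTHESIS-FREE PV2T COLUMN — the twisted one-link Poincaré constant, the every-d mass gap (d−1)|β_W| ≤ 23/20 with rows d = 3..6, the ℤ⁴/ℤ³ ball
segments to β_W = 2/5 / 3/5 and the area-law segments to 1/2 / 4/5 (T71 = T71a–d). All unconditional; strong-coupling lattice statements on balls of
actions / finite-torus facts; every window or radius is where a bound closes; nothing continuum, nothing about the Millennium problem. -/
def YMGapStatementV1_15 : Prop :=
  YMGapStatementV1_14 ∧ T66_SpecificationConcentration ∧ T71_SU3PV2TColumn

/-- The v1.15 draft statement is PROVED. -/
theorem yMGapStatementV1_15_holds : YMGapStatementV1_15 :=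
  ⟨yMGapStatementV1_14_holds, T66_SpecificationConcentration_holds, T71_SU3PV2TColumn_holds⟩

/-- **The venture statement, DRAFT v1.16** (bodies in `StatementConjunctsV23E` + `StatementConjunctsV23F`): `YMGapStatementV1_15 ∧ T65c ∧ T75 ∧ T76 ∧ T77
∧ T78 ∧ T79 ∧ T80 ∧ T81` — COMBINED APPEND under lead g13's R349 (A) / R360 over the blocks whose oleans are BUILT (V23E + V23F = the planned v1.17 +
v1.18; conjunct set of record grows by these eight now, T72–T74 (V23D) follow in the next append; version numbers shift): THE CENTRE-BLIND BALL WINDOW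
for SU(2), d = 4 — AreaLawCentreBlind 2 4 β with ONE (C, c) on every torus for EVERY linkwise centre-blind perturbation whenever tanh(2|β|) ≤ 23/120,
clean row 4/21, two cells and the exact certificate core number (T65c); FLUCTUATION–RESPONSE for SU(2) on ℤ⁴ inside the vertex-star window 0 < β_W <
9/25 — the coupling-derivative of the plaquette expectation equals the susceptibility, the lattice specific heat ¼ f″ is the energy-fluctuation
density of the unique state, the empirical energy density converges a.s. (T75 = T75a–c); NO FIRST-ORDER TRANSITION ON THE TIER-1 TORUS BALL INSIDE THE
DOOR + Lipschitz dependence of torus states on the coupling (T76 = T76a,b); the ALL-COUPLING PERIMETER-TYPE BOUND |⟨½ tr U_{∂R×T}⟩_{β,W,L}| ≤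
tanh(2(d−1)·2|β|)^{R+T−1} for every twist-blind perturbation on every torus (T77; not an area law); COMPLETE (Hsu–Robbins-type) CONVERGENCE of cube
averages at the SU(2) Wilson point 0 ≤ β_W ≤ 1/12 (T78); SU(2) ℤ⁴ BOUNDARY DECAY and FINITE-VOLUME CLUSTERING WITH ANY BOUNDARY FIELD at the star rate
on the whole window 0 ≤ β_W ≤ 9/25 (T79, T80; door artefacts, interior form); the DOBRUSHIN–SHLOSMAN CONDITION-I SHAPE of the free energy with a
frozen boundary field — volume term + boundary-uniform surface term (T81). All unconditional; strong-coupling lattice statements on balls of actions /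
finite-torus facts; every window or radius is where a bound closes; nothing continuum, nothing about the Millennium problem. -/
def YMGapStatementV1_16 : Prop :=
  YMGapStatementV1_15 ∧ T65c_CentreBlindBall ∧ T75_SU2FluctuationDissipation ∧ T76_BallThermodynamicRegularity ∧
    T77_CentreBlindZ2Perimeter ∧ T78_SU2WilsonCompleteConvergence ∧ T79_SU2WilsonBoundaryStar ∧ T80_SU2WilsonKernelClusteringStar ∧
    T81_SU2BoundaryFreeEnergy

/-- The v1.16 draft statement is PROVED. -/
theorem yMGapStatementV1_16_holds : YMGapStatementV1_16 :=
  ⟨yMGapStatementV1_15_holds, T65c_CentreBlindBall_holds, T75_SU2FluctuationDissipation_holds, T76_BallThermodynamicRegularity_holds,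
    T77_CentreBlindZ2Perimeter_holds, T78_SU2WilsonCompleteConvergence_holds, T79_SU2WilsonBoundaryStar_holds,
    T80_SU2WilsonKernelClusteringStar_holds, T81_SU2BoundaryFreeEnergy_holds⟩

/-- **The venture statement, DRAFT v1.17** (bodies in `StatementConjunctsV23G`): `YMGapStatementV1_16 ∧ T82 ∧ T83` — EXACT ONE-LINK GROUP INTEGRALS:
∫_{SU(3)}(tr U)³ = 1, ∫_{SU(3)}(Re tr U)³ = 1/4, the third character moment vanishes for every SU(N), N ≠ 3, and ∫_{SU(2)}(Re tr U)⁶ = 5 (T82 =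
T82a,b); THE REAL-ANALYTIC STRONG-COUPLING CORNER: the SU(2) ℤ⁴ free energy density is real-analytic with CONVERGENT Balian–Drouffe–Itzykson series on
|β| < (e²·16·257²)⁻¹, bounded cylinder expectations along any DLR selection are real-analytic there, for every compact G / representation / dimension
a DLR selection with real-analytic expectations and a real-analytic SU(N) free energy on |β| < plaqRadius, ZERO-FREE SU(N) torus partition functions
on that disc, and Cauchy bounds on the BDI coefficients (T83 = T83a–f) — the radius is where the Kotecký–Preiss bound closes (≈ 10⁻⁷), a door
artefact; T72–T74 (V23D, accepted earlier) precede T82–T83 in numbering and join at the next edition when their olean builds (lead g13 R377 (B)). All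
unconditional; strong-coupling lattice statements on balls of actions / finite-torus facts; every window or radius is where a bound closes; nothing
continuum, nothing about the Millennium problem. -/
def YMGapStatementV1_17 : Prop :=
  YMGapStatementV1_16 ∧ T82_HaarThirdAndSixthMoments ∧ T83_StrongCouplingAnalyticCorner

/-- The v1.17 draft statement is PROVED. -/
theorem yMGapStatementV1_17_holds : YMGapStatementV1_17 :=
  ⟨yMGapStatementV1_16_holds, T82_HaarThirdAndSixthMoments_holds, T83_StrongCouplingAnalyticCorner_holds⟩

/-- **The venture statement, DRAFT v1.18** (bodies in `StatementConjunctsV23H` + `StatementConjunctsV23I`): `YMGapStatementV1_17 ∧ T84 ∧ T85 ∧ T86 ∧ T87 ∧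
T88 ∧ T89 ∧ T90 ∧ T91` — THE LOCAL-SOURCE PACKAGE for every SU(N): Feynman–Hellmann + real-analyticity in the strength of ONE inserted loop on the 't
Hooft corner β < 1/64, a MASS GAP (exponential clustering with explicit comparison-rate lower bounds) surviving one local source of ANY strength, Le
Chatelier monotonicity at the SU(2) Wilson point, and the same clustering uniformly on the all-N gauge ball and the loop ball (T84 = T84a–e); FINITE-
VOLUME CLUSTERING UNIFORM IN THE VOLUME AND THE BOUNDARY FIELD — the generic Dobrushin-regime kernel covariance estimate (Kantorovich form), SU(2) ℤ⁴
Wilson kernels at β_W ≤ 1/12 and the tier-1 ball (T85 = T85a–c); SU(2) FUNCTIONAL INEQUALITIES OF THE DYNAMICS — the gradient-form Langevin Poincaré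
inequality uniformly in the volume on 0 ≤ β_W < 2/9 (d = 3: 1/3), on the torus ball, for every finite-volume kernel and every limit state, and the
Glauber spectral gap ≥ 2/5 on the torus ball (T86 = T86a–f); ONE-LINK FUNCTIONAL INEQUALITIES — the twisted one-link Poincaré constant for EVERY SU(N)
strictly beyond Bakry–Émery (gain O(1/N²), no N-uniform improvement), SU(4) rows, the SU(3) trace-norm constant (T87 = T87a–d); a finite-volume
ENERGY-VARIANCE CEILING Var(Σ_P W_p) ≤ χ·#P for SU(2) ℤ⁴ Wilson kernels at β_W ≤ 1/12 uniformly in volume, boundary field and region (T88); SU(3)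
AREA-LAW SEGMENTS (d = 4 to β_W = 3/5, d = 3 to 9/10) and the d = 4 string-tension reading on ONE tier-1 ball (7/500, 7/1000) (T89 = T89a,b); DLR
UNIQUENESS for EVERY compact gauge group in a unitary representation on the total-variation Dobrushin corner 6(d−1)N|β| < 1 with full torus-sequence
convergence (T90); the Dobrushin–Shlosman CONDITION-I SHAPE of the SU(N) free energy — boundary-uniform additivity with door constants, every N ≥ 2,
every d ≥ 2 (T91); T72–T74 (V23D) precede T82+ in numbering and join when their olean builds (lead g13 R377 (B) / lead g14 R380). All unconditional;
strong-coupling lattice statements on balls of actions / finite-torus facts; every window or radius is where a bound closes; nothing continuum,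
nothing about the Millennium problem. -/
def YMGapStatementV1_18 : Prop :=
  YMGapStatementV1_17 ∧ T84_LocalSourceResponseAndMassGap ∧ T85_KernelClusteringDobrushin ∧ T86_LangevinAndGlauberPoincare ∧
    T87_TwistedOneLinkPoincareEveryN ∧ T88_SU2WilsonKernelEnergyVariance ∧ T89_SU3BallAreaLawAndStringTensionPV2Tr ∧
    T90_UnitaryStrongCouplingCornerSharp ∧ T91_SUNBoundaryFreeEnergyDim

/-- The v1.18 draft statement is PROVED. -/
theorem yMGapStatementV1_18_holds : YMGapStatementV1_18 :=
  ⟨yMGapStatementV1_17_holds, T84_LocalSourceResponseAndMassGap_holds, T85_KernelClusteringDobrushin_holds,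
    T86_LangevinAndGlauberPoincare_holds, T87_TwistedOneLinkPoincareEveryN_holds, T88_SU2WilsonKernelEnergyVariance_holds,
    T89_SU3BallAreaLawAndStringTensionPV2Tr_holds, T90_UnitaryStrongCouplingCornerSharp_holds, T91_SUNBoundaryFreeEnergyDim_holds⟩

/-- **The venture statement, DRAFT v1.19** (bodies in `StatementConjunctsV23J`): `YMGapStatementV1_18 ∧ T92 ∧ T93 ∧ T94` — PURE COMPACT-GROUP INTEGRATION
and EXACT β = 0 FACTS: ∫_{SU(N)} |U₀₀|⁴ = 2/(N(N+1)), ∫_{SU(N)} |tr U|⁴ = 2 (N ≥ 3), ∫_{SU(N)} (Re tr U)⁴ = 3/4 (N ≥ 3, N ≠ 4), the vanishing fourth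
cumulant of the SU(3) plaquette variable under Haar measure and the identically vanishing joint fourth cumulant of SU(3) plaquette variables under the
infinite Haar product — inputs of the strong-coupling expansion, nothing about β > 0 (T92 = T92a–c); SU(2) on ℤ⁴, Wilson action, EVERY 0 ≤ β_W ≤ 9/25:
the finite-volume plaquette SUSCEPTIBILITY on centred boxes is bounded by ONE explicit constant for all boxes and all boundary fields, converges to
the infinite-volume susceptibility for every boundary sequence at an explicit geometric rate, and the boundary influence on a plaquette expectation
decays geometrically in the depth — door artefacts, not measured correlation lengths (T93 = T93a–d); SU(2), EVERY DLR state on the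
Kantorovich–Rubinstein window 0 ≤ β_W < 2/9 (d = 3: 1/3): the gradient-form Langevin Poincaré inequality with constant ((1 − 9β_W/2)(1 − 3β_W))⁻¹, the
Glauber Poincaré inequality with constant (2 − 9β_W)⁻¹, exponential concentration of local Lipschitz observables, and the heat-bath Poincaré
inequality of every DLR state of every member of the ℤ^d ball — functional inequalities, «gap» = Poincaré constant⁻¹, no dynamics object constructed
(T94 = T94a–e); T72–T74 (V23D, accepted earlier) precede T82+ in numbering and join when their olean builds (lead g13 R377 (B) / lead g14 R385 (C),
R389). All unconditional; strong-coupling lattice statements on balls of actions / finite-torus facts; every window or radius is where a bound closes;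
nothing continuum, nothing about the Millennium problem. -/
def YMGapStatementV1_19 : Prop :=
  YMGapStatementV1_18 ∧ T92_HaarFourthMomentsAndCumulants ∧ T93_SU2WilsonStarSusceptibility ∧ T94_SU2GibbsStateFunctionalInequalities

/-- The v1.19 draft statement is PROVED. -/
theorem yMGapStatementV1_19_holds : YMGapStatementV1_19 :=
  ⟨yMGapStatementV1_18_holds, T92_HaarFourthMomentsAndCumulants_holds, T93_SU2WilsonStarSusceptibility_holds,
    T94_SU2GibbsStateFunctionalInequalities_holds⟩

end Summit.Ventures.YMGap

end
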